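import Literature.NumberTheory.LFunctions.Zhang2022.Section15U009Core
import Literature.NumberTheory.LFunctions.Zhang2022.Section17Eq177HeadMoments
import Literature.NumberTheory.LFunctions.Zhang2022.RepairGapProp21ScaleLaw
import HarnessLib

/-!
# Zhang (2022), rescue GAP/REQSIDE (D-0124 (4)–(5)): the SCALE LAWS of the three remaining `Ψ₂`-cores
# of Part III — §15 u009 (`k̃·B`), §17 (17.2) extension (`K_M·F̄`), §17 (17.7) head (`ϱ*_≤·BGNN`): rate
# `𝔓𝓛^{−k}` from Proposition 2.1 at exponent `663 + 4k` / `503 + 4k` / `679 + 4k`, i.e. from (A) at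
# `1946 + 4k` / `1786 + 4k` / `1962 + 4k` — the typed rates `𝓛⁻¹⁹` / `𝓛⁻⁵⁹` / `𝓛⁻¹⁵` cost EXACTLY the printed `2022`

Topic `Literature/NumberTheory/LFunctions/Zhang2022` (Landau–Siegel audit tree; verdict-neutral).
Y. Zhang, *Discrete mean estimates and the Landau–Siegel zero*, arXiv:2211.02515v1 (2022)
[Zhang2022LandauSiegel] — **an unrefereed manuscript under adjudication; nothing in this file asserts or
denies its Theorems 1–2, and nothing here is a claim about Landau–Siegel zeros. The programme SEARCHES and
TYPES; no claim about Landau–Siegel zeros, Theorems 1–2 of arXiv:2211.02515 or a repaired Margin232 until a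
kernel theorem says so.**

"In a way similar to the proof of (7.5), by Proposition 2.1 … the sum over `ψ ∈ Ψ₁` can be extended to `Ψ`"
(§15 p. 80, §17 pp. 95–97). The tree's three Part-III instances of the Hölder chain `X⁴ ≤ U²V·#Ψ₂`
(`Typed.Sec14.Eq143.pow_four_le`) with `#Ψ₂ ≤ C₂₁𝔓𝓛⁻⁷³⁹` (Prop. 2.1) and `P² ≤ 2𝔓𝓛⁷⁷`:
`Typed.Section15A.U009.core` (`U, V ≪ P²𝓛¹⁴⁴`: count `2(144+77)+(144+77) = 663`, typed rate `𝓛⁻¹⁹ = 𝓛^{−(739−663)/4}`),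
`Eq172.core172` (`U ≪ P²𝓛⁶⁴`, `V ≪ P²𝓛¹⁴⁴`: count `503`, rate `𝓛⁻⁵⁹`), `Eq177.core177` (`U ≪ P²𝓛⁴⁸`, `V ≪ P²𝓛³⁵²`:
count `679`, rate `𝓛⁻¹⁵`). Each typed rate consumes Proposition 2.1's `739` EXACTLY (no slack), hence — through the
Part-I law `Repair.Gap.prop21_scale_of_assumptionAWith` (`E = e + 1283`) — exactly the printed (A)-exponent `2022`.
This file re-runs the three cores with Proposition 2.1's exponent free and the rate as a parameter (the tree proofs
verbatim, `739 ↦ count + 4k`; each in its source namespace so that every unqualified name resolves as in the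
source, new names `core_scale_of_prop21_rate` / `core_scale_of_assumptionAWith`):

* `Typed.Section15A.U009.core_scale_of_prop21_rate` / `…_of_assumptionAWith` — §15 u009: rate `𝓛^{−k}` from
  `#Ψ₂ ≪ 𝔓𝓛^{−(663+4k)}`, i.e. from `AssumptionAWith E`, `E ≥ 1946 + 4k`, `k ≤ 19`;
* `Eq172.core_scale_of_prop21_rate` / `…_of_assumptionAWith` — (17.2) extension: from `#Ψ₂ ≪ 𝔓𝓛^{−(503+4k)}`,
  `E ≥ 1786 + 4k`, `k ≤ 59`;
* `Eq177.core_scale_of_prop21_rate` / `…_of_assumptionAWith` — (17.7) head: from `#Ψ₂ ≪ 𝔓𝓛^{−(679+4k)}`,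
  `E ≥ 1962 + 4k`, `k ≤ 15`.

READING (GAP G-31 / REQSIDE (5), as-typed; companion of `RepairGapEq75ScaleLaw` / `RepairGapEq143ScaleLaw`): every
typed consumer of `#Ψ₂` now has a kernel exponent law. For `o(𝔓)`-level use the binding requirement on Prop. 2.1
stays `e ≥ 718` ((7.5), (14.3)) ⇒ `E ≥ 2001`; the TYPED rates of these three Part-III cores are tighter and cost
`2022` on the nose — re-typing the DAG below `2022` means weakening exactly these three node rates (their consumers
are `ε𝔓`-statements). Sufficiency only; theorems only; no definition, no named fact; nothing about (A).

## References

* Y. Zhang, arXiv:2211.02515v1 (2022), §15 p. 80; §17 (17.2) p. 95, (17.7) p. 97; §7 (7.5) p. 35; §2 Prop. 2.1;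
  §3 Lemma 3.3. [cite: Zhang2022LandauSiegel, §15 p. 80; §17 (17.2), (17.7); §7 (7.5)]
-/

noncomputable section

/-! ## §15 u009: `Σ_{ψ∈Ψ₂} |Σ_{m≤P²} k̃(m)ψ̄(m)m^{−(1−s)}|·|B(s,ψ)|` -/

namespace Literature.NumberTheory.LFunctions.Zhang2022.Typed.Section15A.U009

open Finset Complex Real
open scoped ComplexConjugate
open Skeleton MeanSquareMajorant Section7Eq75 Typed.Sec14.Eq143
open Literature.NumberTheory.LFunctions.Zhang2022.Repair.Bed (AssumptionAWith)
open Literature.NumberTheory.LFunctions.Zhang2022.Repair.Gap (prop21_scale_of_assumptionAWith)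

/-- **§15 u009 core with Proposition 2.1's exponent free and the rate as a parameter.** GIVEN Lemma 3.3 (ii) and
an eventual count `#Ψ₂ ≤ C·𝔓·(𝓛^{663+4k})⁻¹` under the guard `AssumptionAWith E`, there is `K` such that for all
large `D`, every real primitive `χ (mod D)` with `AssumptionAWith E D χ`, and every `s` with `Re s = ½`:
`Σ_{ψ∈Ψ₂} |Σ_{m≤P²} k̃(m)ψ̄(m)m^{−(1−s)}|·|B(s,ψ)| ≤ K·𝔓·𝓛^{−k}` (the tree's `core` verbatim, `739 ↦ 663 + 4k`:
`X⁴ ≤ c𝔓⁴𝓛^{−4k}`). [cite: Zhang2022LandauSiegel, §15 p. 80, tex L4037; §7 (7.5) p. 35] -/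
theorem core_scale_of_prop21_rate (h33b : Lemma33b) (c' : ℝ) (k : ℕ) {E : ℝ}
    (h21 : ∃ C : ℝ, ForAllLarge fun D _ χ => AssumptionAWith E D χ →
      ((PsiTwo χ).ncard : ℝ) ≤ C * frakP D * (ell D ^ (663 + 4 * k))⁻¹) :
    ∃ K : ℝ, ForAllLarge fun D _ χ => AssumptionAWith E D χ → ∀ s : ℂ, s.re = 1 / 2 →
      ∑ x ∈ finsetOf (PsiTwo χ),
        ‖∑ m ∈ Icc 1 ⌊bigP D ^ 2⌋₊,
            ktilde c' D m * conj (x.ψ (m : ZMod x.p)) * (m : ℂ) ^ (-(1 - s))‖ * ‖Bpoly χ x s‖ ≤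
        K * frakP D * (ell D ^ k)⁻¹ := by
  obtain ⟨C₂₁, D₁, hD₁⟩ := h21
  obtain ⟨C₃₃, h33⟩ := h33b
  set Cb : ℝ := (1 + ‖iota2‖) * (‖iota3‖ + ‖iota4‖) with hCb
  set cU : ℝ := max C₃₃ 0 * (1 ^ 2 * (majorantConst (4 ^ 2) (2 * 4) * 2 ^ (4 ^ 2))) with hcU
  set cV : ℝ := max C₃₃ 0 * ((Cb ^ 2) ^ 2 * (majorantConst (4 ^ 2) (2 * 4) * 2 ^ (4 ^ 2))) with hcV
  set c : ℝ := 8 * cU ^ 2 * cV * max C₂₁ 0 with hc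
  have hM := majorantConst_pos (4 ^ 2) (2 * 4)
  have hCb0 : 0 ≤ Cb := by positivity
  have hcU0 : 0 ≤ cU := by positivity
  have hcV0 : 0 ≤ cV := by positivity
  have hc0 : 0 ≤ c := by positivity
  refine ⟨1 + c, ?_⟩
  obtain ⟨D₂, hD₂⟩ := bigP_sq_le
  obtain ⟨D₄, hD₄⟩ := exists_nat_le_ell 3
  refine ⟨max (max D₁ D₂) D₄, fun D _ χ hD hq hp hA s hs => ?_⟩
  simp only [max_le_iff] at hD
  obtain ⟨⟨hD₁', hD₂'⟩, hD₄'⟩ := hD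
  have hℓ3 : 3 ≤ ell D := hD₄ D hD₄'
  have hℓ : 1 ≤ ell D := by linarith
  have hℓ0 : 0 < ell D := by linarith
  haveI : Fintype (Chr D) := Fintype.ofFinite _
  set ℓ : ℝ := ell D with hℓdef
  set Pf : ℝ := frakP D with hPf
  have hℓne : ℓ ≠ 0 := hℓ0.ne'
  have hPf0 : 0 ≤ Pf := by
    rw [hPf, frakP_eq_sum_primeWindow]; exact sum_nonneg fun p _ => Nat.cast_nonneg p
  have hU := sum_sq_head_le c' hℓ (h33 D) hs
  have hV := sum_pow_four_Bpoly_le χ hℓ3 (h33 D) hs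
  have hS : ((finsetOf (PsiTwo χ)).card : ℝ) ≤ max C₂₁ 0 * Pf * (ℓ ^ (663 + 4 * k))⁻¹ := by
    rw [card_finsetOf (Set.toFinite _)]
    refine (hD₁ D χ hD₁' hq hp hA).trans ?_
    exact mul_le_mul_of_nonneg_right (mul_le_mul_of_nonneg_right (le_max_left _ _) hPf0)
      (inv_nonneg.mpr (pow_nonneg hℓ0.le _))
  have hP2 : bigP D ^ 2 ≤ 2 * Pf * ℓ ^ 77 := hD₂ D hD₂'
  have hP20 : 0 ≤ bigP D ^ 2 := sq_nonneg _
  have hpow : (2 * ell D ^ 9) ^ (4 ^ 2) = 2 ^ (4 ^ 2) * ℓ ^ 144 := by rw [hℓdef]; ring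
  have hU' : ∑ x : Chr D, ‖∑ m ∈ Icc 1 ⌊bigP D ^ 2⌋₊,
      ktilde c' D m * conj (x.ψ (m : ZMod x.p)) * (m : ℂ) ^ (-(1 - s))‖ ^ 2 ≤ cU * bigP D ^ 2 * ℓ ^ 144 := by
    refine hU.trans (le_of_eq ?_); rw [hcU, hpow]; ring
  have hV' : ∑ x : Chr D, ‖Bpoly χ x s‖ ^ 4 ≤ cV * bigP D ^ 2 * ℓ ^ 144 := by
    refine hV.trans (le_of_eq ?_); rw [hcV, hpow]; ring
  have hX4 := pow_four_le (finsetOf (PsiTwo χ)) Finset.univ (Finset.subset_univ _)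
    (fun x : Chr D => ‖∑ m ∈ Icc 1 ⌊bigP D ^ 2⌋₊,
      ktilde c' D m * conj (x.ψ (m : ZMod x.p)) * (m : ℂ) ^ (-(1 - s))‖)
    (fun x : Chr D => ‖Bpoly χ x s‖) (fun _ => norm_nonneg _) (fun _ => norm_nonneg _)
  have hUn : 0 ≤ ∑ x : Chr D, ‖∑ m ∈ Icc 1 ⌊bigP D ^ 2⌋₊,
      ktilde c' D m * conj (x.ψ (m : ZMod x.p)) * (m : ℂ) ^ (-(1 - s))‖ ^ 2 :=
    sum_nonneg fun x _ => sq_nonneg _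
  have hVn : 0 ≤ ∑ x : Chr D, ‖Bpoly χ x s‖ ^ 4 := sum_nonneg fun x _ => by positivity
  have h1 := hX4.trans (mul_le_mul (pow_le_pow_left₀ hUn hU' 2) (mul_le_mul hV' hS (Nat.cast_nonneg _)
    (hVn.trans hV')) (mul_nonneg hVn (Nat.cast_nonneg _)) (sq_nonneg _))
  have h2 : (cU * bigP D ^ 2 * ℓ ^ 144) ^ 2 *
      ((cV * bigP D ^ 2 * ℓ ^ 144) * (max C₂₁ 0 * Pf * (ℓ ^ (663 + 4 * k))⁻¹)) ≤
      (cU * (2 * Pf * ℓ ^ 77) * ℓ ^ 144) ^ 2 *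
        ((cV * (2 * Pf * ℓ ^ 77) * ℓ ^ 144) * (max C₂₁ 0 * Pf * (ℓ ^ (663 + 4 * k))⁻¹)) := by
    have : 0 ≤ (ℓ ^ (663 + 4 * k))⁻¹ := inv_nonneg.mpr (pow_nonneg hℓ0.le _)
    gcongr
  have h3 : (cU * (2 * Pf * ℓ ^ 77) * ℓ ^ 144) ^ 2 *
      ((cV * (2 * Pf * ℓ ^ 77) * ℓ ^ 144) * (max C₂₁ 0 * Pf * (ℓ ^ (663 + 4 * k))⁻¹)) =
      c * Pf ^ 4 * (ℓ ^ (4 * k))⁻¹ := by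
    have h663 : ℓ ^ (663 + 4 * k) = (ℓ ^ 77) ^ 2 * (ℓ ^ 144) ^ 2 * ℓ ^ 77 * ℓ ^ 144 * ℓ ^ (4 * k) := by
      rw [← pow_mul, ← pow_mul, ← pow_add, ← pow_add, ← pow_add, ← pow_add]
    rw [hc, h663]; field_simp; ring
  have h4 : c * Pf ^ 4 * (ℓ ^ (4 * k))⁻¹ ≤ ((1 + c) * Pf * (ℓ ^ k)⁻¹) ^ 4 := by
    have hK : c ≤ (1 + c) ^ 4 :=
      (le_add_of_nonneg_left zero_le_one).trans (le_self_pow₀ (by linarith) (by norm_num))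
    calc c * Pf ^ 4 * (ℓ ^ (4 * k))⁻¹ ≤ (1 + c) ^ 4 * Pf ^ 4 * (ℓ ^ (4 * k))⁻¹ := by
          gcongr
      _ = ((1 + c) * Pf * (ℓ ^ k)⁻¹) ^ 4 := by rw [mul_pow, mul_pow, inv_pow, ← pow_mul, mul_comm k 4]
  have hK0 : 0 ≤ (1 + c) * Pf * (ℓ ^ k)⁻¹ := by positivity
  exact le_of_pow_le_pow_left₀ (by norm_num) hK0 (h1.trans (h2.trans (h3.le.trans h4)))

/-- **§15 u009 core under (A) at exponent `E ≥ 1946 + 4k` (`k ≤ 19`)** — over `Skeleton.lemma33b_holds` and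
`prop21_scale_of_assumptionAWith (663 + 4k)`; the typed rate `𝓛⁻¹⁹` is `k = 19`: `E ≥ 2022`, the printed exponent
exactly. [cite: Zhang2022LandauSiegel, §15 p. 80; §2 Prop. 2.1] -/
theorem core_scale_of_assumptionAWith (c' : ℝ) (k : ℕ) (hk : k ≤ 19) {E : ℝ}
    (hE : ((1946 + 4 * k : ℕ) : ℝ) ≤ E) :
    ∃ K : ℝ, ForAllLarge fun D _ χ => AssumptionAWith E D χ → ∀ s : ℂ, s.re = 1 / 2 →
      ∑ x ∈ finsetOf (PsiTwo χ),
        ‖∑ m ∈ Icc 1 ⌊bigP D ^ 2⌋₊,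
            ktilde c' D m * conj (x.ψ (m : ZMod x.p)) * (m : ℂ) ^ (-(1 - s))‖ * ‖Bpoly χ x s‖ ≤
        K * frakP D * (ell D ^ k)⁻¹ :=
  core_scale_of_prop21_rate lemma33b_holds c' k
    (prop21_scale_of_assumptionAWith (663 + 4 * k) (by omega) (by push_cast at hE ⊢; linarith))

end Literature.NumberTheory.LFunctions.Zhang2022.Typed.Section15A.U009

/-! ## §17 (17.2) extension: `Σ_{ψ∈Ψ₂} |K_M(s,ψ)|·|F(1−s,ψ̄)|` -/

namespace Literature.NumberTheory.LFunctions.Zhang2022.Eq172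

open Finset Complex Real MeasureTheory intervalIntegral ComplexConjugate
open Literature.NumberTheory.LFunctions.Zhang2022.Skeleton
open Literature.NumberTheory.LFunctions.Zhang2022.Typed.Section17
open Literature.NumberTheory.LFunctions.Zhang2022.MeanSquareMajorant
open Literature.NumberTheory.LFunctions.Zhang2022.Typed.Sec14.Eq143
open Literature.NumberTheory.LFunctions.Zhang2022.Repair.Bed (AssumptionAWith)
open Literature.NumberTheory.LFunctions.Zhang2022.Repair.Gap (prop21_scale_of_assumptionAWith)

/-- **(17.2)-extension core with Proposition 2.1's exponent free and the rate as a parameter.** GIVEN an eventual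
count `#Ψ₂ ≤ C·𝔓·(𝓛^{503+4k})⁻¹` under the guard `AssumptionAWith E` (Lemma 3.3 (ii) = `Skeleton.lemma33b_holds`),
there is `K` with, for all large `D`, every real primitive `χ (mod D)` with `AssumptionAWith E D χ`, `Re s = ½`:
`Σ_{ψ∈Ψ₂}|K_M(s,ψ)||F(1−s,ψ̄)| ≤ K·𝔓·𝓛^{−k}` (the tree's `core172` verbatim, `739 ↦ 503 + 4k`).
[cite: Zhang2022LandauSiegel, §17 (17.2) p.95; §7 (7.5) p.35] -/
theorem core_scale_of_prop21_rate (c' : ℝ) (k : ℕ) {E : ℝ}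
    (h21 : ∃ C : ℝ, ForAllLarge fun D _ χ => AssumptionAWith E D χ →
      ((PsiTwo χ).ncard : ℝ) ≤ C * frakP D * (ell D ^ (503 + 4 * k))⁻¹) :
    ∃ K : ℝ, ForAllLarge fun D _ χ => AssumptionAWith E D χ → ∀ s : ℂ, s.re = 1 / 2 →
      ∑ x ∈ finsetOf (PsiTwo χ),
        ‖∑ m ∈ Icc 1 (D ^ 240), nuStar c' χ m * psiFn x m * (m : ℂ) ^ (-s)‖ *
          ‖FpolyBar χ x (1 - s)‖ ≤ K * frakP D * (ell D ^ k)⁻¹ := by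
  obtain ⟨C₂₁, D₁, hD₁⟩ := h21
  obtain ⟨C₃₃, h33⟩ := lemma33b_holds
  set Kι : ℝ := (1 + ‖iota2‖) * (‖iota3‖ + ‖iota4‖) with hKι
  have hKι0 : 0 ≤ Kι := Kiota_nonneg
  set cU : ℝ := max C₃₃ 0 * (Kι ^ 2 * (majorantConst 64 16 * 240 ^ 64)) with hcU
  set cV : ℝ := max C₃₃ 0 * (majorantConst 16 8 * 2 ^ 16) with hcV
  set c : ℝ := 8 * cU ^ 2 * cV * max C₂₁ 0 with hc
  have hM64 := majorantConst_pos 64 16; have hM16 := majorantConst_pos 16 8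
  have hcU0 : 0 ≤ cU := by positivity
  have hcV0 : 0 ≤ cV := by positivity
  have hc0 : 0 ≤ c := by positivity
  refine ⟨1 + c, ?_⟩
  obtain ⟨D₂, hD₂⟩ := bigP_sq_le
  obtain ⟨D₃, hD₃⟩ := Section7Eq75.exists_nat_le_ell 3
  refine ⟨max (max D₁ D₂) (max D₃ 3), fun D _ χ hD hq hp hA s hs => ?_⟩
  simp only [max_le_iff] at hD
  obtain ⟨⟨hD₁', hD₂'⟩, hD₃', hD3⟩ := hD
  have hℓ3 : 3 ≤ ell D := hD₃ D hD₃'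
  have hℓ : 1 ≤ ell D := by linarith
  have hℓ0 : 0 < ell D := by linarith
  have hlog2 : 2 ≤ Real.log D := le_trans (by norm_num) hℓ3
  haveI : Fintype (Chr D) := Fintype.ofFinite _
  obtain ⟨hM2, hMP, hlogM, hN⟩ := cut_sizes hD3 hℓ3
  set ℓ : ℝ := ell D with hℓdef; set Pf : ℝ := frakP D with hPf
  have hℓne : ℓ ≠ 0 := hℓ0.ne'
  have hPf0 : 0 ≤ Pf := by
    rw [hPf, frakP_eq_sum_primeWindow]; exact sum_nonneg fun p _ => Nat.cast_nonneg p
  have hU := sum_sq_head_le c' χ hlog2 (h33 D) hM2 hMP hs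
  rw [hlogM] at hU
  have hV := sum_pow_four_F_le χ hℓ hN (h33 D) hs
  have hS : ((finsetOf (PsiTwo χ)).card : ℝ) ≤ max C₂₁ 0 * Pf * (ℓ ^ (503 + 4 * k))⁻¹ := by
    rw [card_finsetOf (Set.toFinite _)]
    refine (hD₁ D χ hD₁' hq hp hA).trans ?_
    exact mul_le_mul_of_nonneg_right (mul_le_mul_of_nonneg_right (le_max_left _ _) hPf0)
      (inv_nonneg.mpr (pow_nonneg hℓ0.le _))
  have hP2 : bigP D ^ 2 ≤ 2 * Pf * ℓ ^ 77 := hD₂ D hD₂'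
  have hP20 : 0 ≤ bigP D ^ 2 := sq_nonneg _
  have hU' : ∑ x : Chr D, ‖∑ m ∈ Icc 1 (D ^ 240), nuStar c' χ m * psiFn x m * (m : ℂ) ^ (-s)‖ ^ 2
      ≤ cU * bigP D ^ 2 * ℓ ^ 64 := by
    refine hU.trans (le_of_eq ?_); rw [hcU, mul_pow]; ring
  have hV' : ∑ x : Chr D, ‖FpolyBar χ x (1 - s)‖ ^ 4 ≤ cV * bigP D ^ 2 * ℓ ^ 144 := by
    refine hV.trans (le_of_eq ?_); rw [hcV, mul_pow, ← pow_mul]; ring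
  have hX4 := pow_four_le (finsetOf (PsiTwo χ)) Finset.univ (Finset.subset_univ _)
    (fun x : Chr D => ‖∑ m ∈ Icc 1 (D ^ 240), nuStar c' χ m * psiFn x m * (m : ℂ) ^ (-s)‖)
    (fun x : Chr D => ‖FpolyBar χ x (1 - s)‖)
    (fun _ => norm_nonneg _) (fun _ => norm_nonneg _)
  have hUn : 0 ≤ ∑ x : Chr D,
      ‖∑ m ∈ Icc 1 (D ^ 240), nuStar c' χ m * psiFn x m * (m : ℂ) ^ (-s)‖ ^ 2 :=
    sum_nonneg fun x _ => sq_nonneg _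
  have hVn : 0 ≤ ∑ x : Chr D, ‖FpolyBar χ x (1 - s)‖ ^ 4 := sum_nonneg fun x _ => by positivity
  have h1 := hX4.trans (mul_le_mul (pow_le_pow_left₀ hUn hU' 2) (mul_le_mul hV' hS (Nat.cast_nonneg _)
    (hVn.trans hV')) (mul_nonneg hVn (Nat.cast_nonneg _)) (sq_nonneg _))
  have h2 : (cU * bigP D ^ 2 * ℓ ^ 64) ^ 2 *
      ((cV * bigP D ^ 2 * ℓ ^ 144) * (max C₂₁ 0 * Pf * (ℓ ^ (503 + 4 * k))⁻¹)) ≤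
      (cU * (2 * Pf * ℓ ^ 77) * ℓ ^ 64) ^ 2 *
        ((cV * (2 * Pf * ℓ ^ 77) * ℓ ^ 144) * (max C₂₁ 0 * Pf * (ℓ ^ (503 + 4 * k))⁻¹)) := by
    have : 0 ≤ (ℓ ^ (503 + 4 * k))⁻¹ := inv_nonneg.mpr (pow_nonneg hℓ0.le _)
    gcongr
  have h3 : (cU * (2 * Pf * ℓ ^ 77) * ℓ ^ 64) ^ 2 *
      ((cV * (2 * Pf * ℓ ^ 77) * ℓ ^ 144) * (max C₂₁ 0 * Pf * (ℓ ^ (503 + 4 * k))⁻¹)) =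
      c * Pf ^ 4 * (ℓ ^ (4 * k))⁻¹ := by
    have h503 : ℓ ^ (503 + 4 * k) = (ℓ ^ 77) ^ 2 * (ℓ ^ 64) ^ 2 * ℓ ^ 77 * ℓ ^ 144 * ℓ ^ (4 * k) := by
      rw [← pow_mul, ← pow_mul, ← pow_add, ← pow_add, ← pow_add, ← pow_add]
    rw [hc, h503]; field_simp; ring
  have h4 : c * Pf ^ 4 * (ℓ ^ (4 * k))⁻¹ ≤ ((1 + c) * Pf * (ℓ ^ k)⁻¹) ^ 4 := by
    have hK : c ≤ (1 + c) ^ 4 :=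
      (le_add_of_nonneg_left zero_le_one).trans (le_self_pow₀ (by linarith) (by norm_num))
    calc c * Pf ^ 4 * (ℓ ^ (4 * k))⁻¹ ≤ (1 + c) ^ 4 * Pf ^ 4 * (ℓ ^ (4 * k))⁻¹ := by gcongr
      _ = ((1 + c) * Pf * (ℓ ^ k)⁻¹) ^ 4 := by rw [mul_pow, mul_pow, inv_pow, ← pow_mul, mul_comm k 4]
  have hK0 : 0 ≤ (1 + c) * Pf * (ℓ ^ k)⁻¹ := by positivity
  exact le_of_pow_le_pow_left₀ (by norm_num) hK0 (h1.trans (h2.trans (h3.le.trans h4)))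

/-- **(17.2)-extension core under (A) at exponent `E ≥ 1786 + 4k` (`k ≤ 59`)** — over
`prop21_scale_of_assumptionAWith (503 + 4k)`; the typed rate `𝓛⁻⁵⁹` is `k = 59`: `E ≥ 2022`, the printed exponent
exactly. [cite: Zhang2022LandauSiegel, §17 (17.2) p.95; §2 Prop. 2.1] -/
theorem core_scale_of_assumptionAWith (c' : ℝ) (k : ℕ) (hk : k ≤ 59) {E : ℝ}
    (hE : ((1786 + 4 * k : ℕ) : ℝ) ≤ E) :
    ∃ K : ℝ, ForAllLarge fun D _ χ => AssumptionAWith E D χ → ∀ s : ℂ, s.re = 1 / 2 →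
      ∑ x ∈ finsetOf (PsiTwo χ),
        ‖∑ m ∈ Icc 1 (D ^ 240), nuStar c' χ m * psiFn x m * (m : ℂ) ^ (-s)‖ *
          ‖FpolyBar χ x (1 - s)‖ ≤ K * frakP D * (ell D ^ k)⁻¹ :=
  core_scale_of_prop21_rate c' k
    (prop21_scale_of_assumptionAWith (503 + 4 * k) (by omega) (by push_cast at hE ⊢; linarith))

end Literature.NumberTheory.LFunctions.Zhang2022.Eq172

/-! ## §17 (17.7) head: `Σ_{ψ∈Ψ₂} |Σ_{n≤⌊P²⌋}ϱ*_≤(n)ψ̄(n)n^{−(1−s)}|·|BGNN(s,ψ)|` -/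

namespace Literature.NumberTheory.LFunctions.Zhang2022.Eq177

open Finset Complex Real ComplexConjugate
open Literature.NumberTheory.LFunctions.Zhang2022.Skeleton
open Literature.NumberTheory.LFunctions.Zhang2022.Typed.Section17
open Literature.NumberTheory.LFunctions.Zhang2022.MeanSquareMajorant
open Literature.NumberTheory.LFunctions.Zhang2022.Typed.Sec14.Eq143
open scoped LSeries.notation
open Literature.NumberTheory.LFunctions.Zhang2022.Repair.Bed (AssumptionAWith)
open Literature.NumberTheory.LFunctions.Zhang2022.Repair.Gap (prop21_scale_of_assumptionAWith)

/-- **(17.7)-head core with Proposition 2.1's exponent free and the rate as a parameter.** GIVEN an eventual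
count `#Ψ₂ ≤ C·𝔓·(𝓛^{679+4k})⁻¹` under the guard `AssumptionAWith E` (Lemma 3.3 (ii) = `Skeleton.lemma33b_holds`),
there is `K` with, for all large `D`, every real primitive `χ (mod D)` with `AssumptionAWith E D χ`, `Re s = ½`:
`Σ_{ψ∈Ψ₂}|Σ_{n≤⌊P²⌋}ϱ*_≤(n)ψ̄(n)n^{−(1−s)}|·|B G N N(s,ψ)| ≤ K·𝔓·𝓛^{−k}` (the tree's `core177` verbatim,
`739 ↦ 679 + 4k`). [cite: Zhang2022LandauSiegel, §17 (17.7) p.97; §7 (7.5) p.35] -/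
theorem core_scale_of_prop21_rate (c' : ℝ) (k : ℕ) {E : ℝ}
    (h21 : ∃ C : ℝ, ForAllLarge fun D _ χ => AssumptionAWith E D χ →
      ((PsiTwo χ).ncard : ℝ) ≤ C * frakP D * (ell D ^ (679 + 4 * k))⁻¹) :
    ∃ K : ℝ, ForAllLarge fun D _ χ => AssumptionAWith E D χ → ∀ s : ℂ, s.re = 1 / 2 →
      ∑ x ∈ finsetOf (PsiTwo χ),
        ‖∑ n ∈ Icc 1 ⌊bigP D ^ 2⌋₊,
            (LSeries.convolution (trunc (D ^ 4) (nu χ)) (kappa2bar c' D)) n *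
              conj (x.ψ (n : ZMod x.p)) * (n : ℂ) ^ (-(1 - s))‖ *
          ‖Bpoly χ x s * Gpoly χ x s * Nchar D (psiFn x) (s + beta2 c' D) *
            Nchar D (psiFn x) (s + beta3 c' D)‖ ≤ K * frakP D * (ell D ^ k)⁻¹ := by
  obtain ⟨C₂₁, D₁, hD₁⟩ := h21
  obtain ⟨C₃₃, h33⟩ := lemma33b_holds
  set Kι : ℝ := (1 + ‖iota2‖) * (‖iota3‖ + ‖iota4‖) with hKι
  have hKι0 : 0 ≤ Kι := Eq172.Kiota_nonneg
  set cU : ℝ := max C₃₃ 0 * (majorantConst 16 10 * (2 ^ 4 * 4 ^ 12)) with hcU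
  set cV : ℝ := max C₃₃ 0 * (Kι ^ 4 * (majorantConst 144 30 * (2 ^ 16 * 3 ^ 80 * 4 ^ 48))) with hcV
  set c : ℝ := 8 * cU ^ 2 * cV * max C₂₁ 0 with hc
  have hM16 := majorantConst_pos 16 10; have hM144 := majorantConst_pos 144 30
  have hcU0 : 0 ≤ cU := by positivity
  have hcV0 : 0 ≤ cV := by positivity
  have hc0 : 0 ≤ c := by positivity
  refine ⟨1 + c, ?_⟩
  obtain ⟨D₂, hD₂⟩ := bigP_sq_le
  obtain ⟨D₃, hD₃⟩ := Section7Eq75.exists_nat_le_ell 4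
  refine ⟨max (max D₁ D₂) (max D₃ 3), fun D _ χ hD hq hp hA s hs => ?_⟩
  simp only [max_le_iff] at hD
  obtain ⟨⟨hD₁', hD₂'⟩, hD₃', hD3⟩ := hD
  have hℓ4 : 4 ≤ ell D := hD₃ D hD₃'
  have hℓ : 1 ≤ ell D := by linarith
  have hℓ0 : 0 < ell D := by linarith
  haveI : Fintype (Chr D) := Fintype.ofFinite _
  obtain ⟨hP2, hy2, hD42⟩ := sizes_two_le hD3 hℓ
  set ℓ : ℝ := ell D with hℓdef; set Pf : ℝ := frakP D with hPf
  have hℓne : ℓ ≠ 0 := hℓ0.ne'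
  have hPf0 : 0 ≤ Pf := by
    rw [hPf, frakP_eq_sum_primeWindow]; exact sum_nonneg fun p _ => Nat.cast_nonneg p
  have hw : (1 - s).re = 1 / 2 := by simp [hs]; norm_num
  have hU := sum_sq_head177_le c' χ hℓ hD42 (h33 D) hw
  have hV := sum_pow_four_BGNN_le c' χ hD3 hℓ4 (h33 D) hs
  -- the logarithms as powers of `𝓛`
  have hlogy := log_ceil_two_bigT_sq_le (D := D) (by linarith) hy2
  have hlogy0 : 0 ≤ Real.log (⌈2 * bigT D ^ 2⌉₊ : ℝ) := Real.log_natCast_nonneg _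
  rw [log_pow_four_eq D] at hU hV
  have hU' : ∑ x : Chr D, ‖∑ n ∈ Icc 1 ⌊bigP D ^ 2⌋₊,
      (LSeries.convolution (trunc (D ^ 4) (nu χ)) (kappa2bar c' D)) n *
        conj (x.ψ (n : ZMod x.p)) * (n : ℂ) ^ (-(1 - s))‖ ^ 2 ≤ cU * bigP D ^ 2 * ℓ ^ 48 := by
    refine hU.trans (le_of_eq ?_); rw [hcU]; ring
  have hV' : ∑ x : Chr D, ‖Bpoly χ x s * Gpoly χ x s * Nchar D (psiFn x) (s + beta2 c' D) *
      Nchar D (psiFn x) (s + beta3 c' D)‖ ^ 4 ≤ cV * bigP D ^ 2 * ℓ ^ 352 := by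
    refine hV.trans ?_
    have e80 : Real.log (⌈2 * bigT D ^ 2⌉₊ : ℝ) ^ 80 ≤ (3 * ℓ ^ 2) ^ 80 := pow_le_pow_left₀ hlogy0 hlogy 80
    have hP20 : 0 ≤ max C₃₃ 0 * bigP D ^ 2 := mul_nonneg (le_max_right _ _) (sq_nonneg _)
    calc max C₃₃ 0 * bigP D ^ 2 * (Kι ^ 4 * (majorantConst 144 30 *
          ((2 * ℓ ^ 9) ^ 16 * Real.log (⌈2 * bigT D ^ 2⌉₊ : ℝ) ^ 80 * (4 * ℓ) ^ 48)))
        ≤ max C₃₃ 0 * bigP D ^ 2 * (Kι ^ 4 * (majorantConst 144 30 *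
          ((2 * ℓ ^ 9) ^ 16 * (3 * ℓ ^ 2) ^ 80 * (4 * ℓ) ^ 48))) := by gcongr
      _ = cV * bigP D ^ 2 * ℓ ^ 352 := by rw [hcV]; ring
  have hS : ((finsetOf (PsiTwo χ)).card : ℝ) ≤ max C₂₁ 0 * Pf * (ℓ ^ (679 + 4 * k))⁻¹ := by
    rw [card_finsetOf (Set.toFinite _)]
    refine (hD₁ D χ hD₁' hq hp hA).trans ?_
    exact mul_le_mul_of_nonneg_right (mul_le_mul_of_nonneg_right (le_max_left _ _) hPf0)
      (inv_nonneg.mpr (pow_nonneg hℓ0.le _))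
  have hP2' : bigP D ^ 2 ≤ 2 * Pf * ℓ ^ 77 := hD₂ D hD₂'
  have hP20 : 0 ≤ bigP D ^ 2 := sq_nonneg _
  have hX4 := pow_four_le (finsetOf (PsiTwo χ)) Finset.univ (Finset.subset_univ _)
    (fun x : Chr D => ‖∑ n ∈ Icc 1 ⌊bigP D ^ 2⌋₊,
      (LSeries.convolution (trunc (D ^ 4) (nu χ)) (kappa2bar c' D)) n *
        conj (x.ψ (n : ZMod x.p)) * (n : ℂ) ^ (-(1 - s))‖)
    (fun x : Chr D => ‖Bpoly χ x s * Gpoly χ x s * Nchar D (psiFn x) (s + beta2 c' D) *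
      Nchar D (psiFn x) (s + beta3 c' D)‖)
    (fun _ => norm_nonneg _) (fun _ => norm_nonneg _)
  have hUn : 0 ≤ ∑ x : Chr D, ‖∑ n ∈ Icc 1 ⌊bigP D ^ 2⌋₊,
      (LSeries.convolution (trunc (D ^ 4) (nu χ)) (kappa2bar c' D)) n *
        conj (x.ψ (n : ZMod x.p)) * (n : ℂ) ^ (-(1 - s))‖ ^ 2 := sum_nonneg fun x _ => sq_nonneg _
  have hVn : 0 ≤ ∑ x : Chr D, ‖Bpoly χ x s * Gpoly χ x s * Nchar D (psiFn x) (s + beta2 c' D) *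
      Nchar D (psiFn x) (s + beta3 c' D)‖ ^ 4 := sum_nonneg fun x _ => by positivity
  have h1 := hX4.trans (mul_le_mul (pow_le_pow_left₀ hUn hU' 2) (mul_le_mul hV' hS (Nat.cast_nonneg _)
    (hVn.trans hV')) (mul_nonneg hVn (Nat.cast_nonneg _)) (sq_nonneg _))
  have h2 : (cU * bigP D ^ 2 * ℓ ^ 48) ^ 2 *
      ((cV * bigP D ^ 2 * ℓ ^ 352) * (max C₂₁ 0 * Pf * (ℓ ^ (679 + 4 * k))⁻¹)) ≤
      (cU * (2 * Pf * ℓ ^ 77) * ℓ ^ 48) ^ 2 *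
        ((cV * (2 * Pf * ℓ ^ 77) * ℓ ^ 352) * (max C₂₁ 0 * Pf * (ℓ ^ (679 + 4 * k))⁻¹)) := by
    have : 0 ≤ (ℓ ^ (679 + 4 * k))⁻¹ := inv_nonneg.mpr (pow_nonneg hℓ0.le _)
    gcongr
  have h3 : (cU * (2 * Pf * ℓ ^ 77) * ℓ ^ 48) ^ 2 *
      ((cV * (2 * Pf * ℓ ^ 77) * ℓ ^ 352) * (max C₂₁ 0 * Pf * (ℓ ^ (679 + 4 * k))⁻¹)) =
      c * Pf ^ 4 * (ℓ ^ (4 * k))⁻¹ := by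
    have h679 : ℓ ^ (679 + 4 * k) = (ℓ ^ 77) ^ 2 * (ℓ ^ 48) ^ 2 * ℓ ^ 77 * ℓ ^ 352 * ℓ ^ (4 * k) := by
      rw [← pow_mul, ← pow_mul, ← pow_add, ← pow_add, ← pow_add, ← pow_add]
    rw [hc, h679]; field_simp; ring
  have h4 : c * Pf ^ 4 * (ℓ ^ (4 * k))⁻¹ ≤ ((1 + c) * Pf * (ℓ ^ k)⁻¹) ^ 4 := by
    have hK : c ≤ (1 + c) ^ 4 :=
      (le_add_of_nonneg_left zero_le_one).trans (le_self_pow₀ (by linarith) (by norm_num))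
    calc c * Pf ^ 4 * (ℓ ^ (4 * k))⁻¹ ≤ (1 + c) ^ 4 * Pf ^ 4 * (ℓ ^ (4 * k))⁻¹ := by gcongr
      _ = ((1 + c) * Pf * (ℓ ^ k)⁻¹) ^ 4 := by rw [mul_pow, mul_pow, inv_pow, ← pow_mul, mul_comm k 4]
  have hK0 : 0 ≤ (1 + c) * Pf * (ℓ ^ k)⁻¹ := by positivity
  exact le_of_pow_le_pow_left₀ (by norm_num) hK0 (h1.trans (h2.trans (h3.le.trans h4)))

/-- **(17.7)-head core under (A) at exponent `E ≥ 1962 + 4k` (`k ≤ 15`)** — over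
`prop21_scale_of_assumptionAWith (679 + 4k)`; the typed rate `𝓛⁻¹⁵` is `k = 15`: `E ≥ 2022`, the printed exponent
exactly. [cite: Zhang2022LandauSiegel, §17 (17.7) p.97; §2 Prop. 2.1] -/
theorem core_scale_of_assumptionAWith (c' : ℝ) (k : ℕ) (hk : k ≤ 15) {E : ℝ}
    (hE : ((1962 + 4 * k : ℕ) : ℝ) ≤ E) :
    ∃ K : ℝ, ForAllLarge fun D _ χ => AssumptionAWith E D χ → ∀ s : ℂ, s.re = 1 / 2 →
      ∑ x ∈ finsetOf (PsiTwo χ),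
        ‖∑ n ∈ Icc 1 ⌊bigP D ^ 2⌋₊,
            (LSeries.convolution (trunc (D ^ 4) (nu χ)) (kappa2bar c' D)) n *
              conj (x.ψ (n : ZMod x.p)) * (n : ℂ) ^ (-(1 - s))‖ *
          ‖Bpoly χ x s * Gpoly χ x s * Nchar D (psiFn x) (s + beta2 c' D) *
            Nchar D (psiFn x) (s + beta3 c' D)‖ ≤ K * frakP D * (ell D ^ k)⁻¹ :=
  core_scale_of_prop21_rate c' k
    (prop21_scale_of_assumptionAWith (679 + 4 * k) (by omega) (by push_cast at hE ⊢; linarith))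

end Literature.NumberTheory.LFunctions.Zhang2022.Eq177

end
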